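import Summits.ABC.IUTFork.Cor312SlotHullLocal
import Summits.ABC.IUTFork.Cor312StatementBridge
import HarnessLib

/-!
# [IUTchIII] Corollary 3.12 over the typed setting — the JUNCTION of the readings (U) and (P) at the level of the NUMBER
# `−|log(Θ)|`: `−|log(Θ)|_(P) ≤ −|log(Θ)|_(U)`, `SlotStatement ⟹ Statement`, and equality / equivalence from local equalities

PROOF-ONLY file (D-0012; no definitions, no `Prop` facts, nothing re-typed) of the abc-iut cell (R2 S-chain team, seat abc-iut-s2-p2
gen 3, self-named row «U-P-JUNCTION-K», part (i): generic over ANY typed setting). TAKES NO SIDE on [IUTchIII] Cor. 3.12, on the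
reading (U)/(P) of `−|log(Θ)|`, or on any author.

S. Mochizuki, *Inter-universal Teichmüller theory III* [Mochizuki2012] (kurims manuscript): Cor. 3.12 p. 173 l. 43 – p. 174 l. 18
(«the holomorphic hull of the union of the possible images of a Θ-pilot object … subject to the indeterminacies (Ind1), (Ind2), (Ind3)»
— READING (U), the cell's frozen `Cor312.Setting.thetaHull` / `negLogTheta` / `Statement`, abc-iut-c312-7); proof Step (x) p. 181 (the
log-volume computed for each possible image) and T. Dupuy, A. Hilado [DupuyHilado2025] §4.9, §4.11–4.12 (the (Ind2)-orbit slot by slot) —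
READING (P), abc-iut-C-cert-2's `Cor312SlotHull` (p458847, abc-iut-c312-1's shape): `thetaSlotHull ⊆ thetaHull`
(`thetaSlotHull_subset_thetaHull`), `negLogThetaSlot`, `SlotStatement`, and the REGION-level junction `licence_of_slotLicence`
((P) ⟹ (U) for the Step (xi-f) inclusion). THIS FILE is the NUMBER-level junction, generic bookkeeping over any `Cor312.Setting`
([IUTchIII] Prop. 3.9 (ii) p. 116: the log-volume is monotone on admissible regions — abc-iut-c312-6's hypothesis `Cor312Vol.LogvolMono`,
PROVED for the cell's real containers in `Cor312BridgeHypsPrVolArch` / `…DHVolArch`):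

* `thetaSlotLocal_untopD_le_thetaLocal_untopD`, `thetaSlotLocal_le_thetaLocal` — per packet `(j, v_ℚ)`, `j ∈ 𝔽_l^⋇`: the slot-hull
  log-volume is at most the full-hull log-volume (hull monotonicity + monotone log-volume);
* **`negLogThetaSlot_le_negLogTheta`** — `−|log(Θ)|_(P) ≤ −|log(Θ)|_(U)` (given `ThetaSlotFinite`; `+∞` on the right otherwise);
* **`statement_of_slotStatement`** — `SlotStatement ⟹ Statement` under `ThetaFinite`: the reading-(P) conclusion of Cor. 3.12 is the
  STRONGER one; so the γ certificate's per-datum binder `hstPBad` (abc-iut-C-cert-2 `abc_of_slotStatement_genuineK_szpiroBad`, p458998)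
  implies the (U) statement lines' `hstBad` (abc-iut-s2-p10 p455513) at every datum where `−|log(Θ)|_(U)` is finite;
* `thetaSlotFinite_iff_thetaFinite_of_forall_eq`, **`negLogThetaSlot_eq_negLogTheta_of_forall_eq`**, **`slotStatement_iff_statement_of_forall_eq`**
  — where the two local terms agree at every `(j, v_ℚ)`, `j ∈ 𝔽_l^⋇` (e.g. wherever the full hull is already the (Ind3)-region, abc-iut-s2-p7
  `thetaSlotLocal_eq_thetaLocal_of_thetaHull_subset`; at SLOT-CONSTANT data, part (ii) `Cor312SlotHullJunctionK`), the two numbers and the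
  two statements COINCIDE; `slotStatement_iff_statement_of_negLogThetaSlot_eq` — the same from equality of the two numbers.

USE (branch C, LETTER C «honest cost of γ»): together with part (ii) (sharp `K`-setting: the two numbers differ by EXACTLY the datum's
(Ind1) slot residue, abc-iut-s2-p2 `ThetaVolumeInput.negLogThetaNonarch_perImage_two_sided_of_slotConstantOn`, up to the rounding sum)
this locates the reading-(P) binders relative to print's reading-(U) binders BY NAME. HONEST SCOPE: identities and inequalities between OUR
two typings; nothing here asserts that either statement holds at any datum; typed ≠ proved; instantiated ≠ endorsed.
[cite: Mochizuki2012, IUTchIII Cor. 3.12 p. 173–174, proof Step (x) p. 181; Prop. 3.9 (ii) p. 116; Rmk. 3.9.5 (ii) p. 127]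
[cite: DupuyHilado2025, §4.9, §4.11–4.12] [claim: Mochizuki2012, status: disputed] for every quoted construction.
-/

noncomputable section

open Set Function

namespace Summit.ABC.IUTFork.Cor312.Setting

open Thm311 Literature.IUT.LogThetaLattice

variable {T : ThetaIndex} {S : Situation T} (P : Setting S)

/-! ## §1. Per packet: the slot-hull log-volume is at most the full-hull log-volume -/

/-- **Per packet, real form**: at a label `j = i+1 ∈ 𝔽_l^⋇` where both hulls are defined, the log-volume of the (Ind1)-free slot hull is
at most that of the hull of the union of ALL possible images (`thetaSlotHull ⊆ thetaHull`, both hull-sets hence admissible, monotone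
log-volume [IUTchIII] Prop. 3.9 (ii)). [cite: Mochizuki2012, IUTchIII Prop. 3.9 (ii) p. 116; Rmk. 3.9.5 (ii) p. 127]
[claim: Mochizuki2012, status: disputed] -/
theorem thetaSlotLocal_untopD_le_thetaLocal_untopD (hmono : Cor312Vol.LogvolMono P) (i : Fin T.lstar) (vQ : T.VQ)
    (hU : P.HullDefined (labelSucc i) vQ) (hP : P.SlotHullDefined (labelSucc i) vQ) :
    (P.thetaSlotLocal (labelSucc i) vQ).untopD 0 ≤ (P.thetaLocal (labelSucc i) vQ).untopD 0 := by
  have hUeq : (P.thetaLocal (labelSucc i) vQ).untopD 0 = (S.D P.n).logvol _ vQ (P.thetaHull (labelSucc i) vQ) := by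
    unfold thetaLocal; rw [if_pos hU, WithTop.untopD_coe]
  rw [P.thetaSlotLocal_untopD_eq hP, hUeq]
  exact hmono i vQ (P.thetaSlotHull_adm hP) (P.thetaHull_adm hU) (P.thetaSlotHull_subset_thetaHull _ vQ)

/-- **Per packet, `WithTop` form**: at a label in `𝔽_l^⋇` where the slot hull is defined, `thetaSlotLocal ≤ thetaLocal` (the right side is
`+∞` when the full hull is undefined). [cite: Mochizuki2012, IUTchIII Prop. 3.9 (ii) p. 116] [claim: Mochizuki2012, status: disputed] -/
theorem thetaSlotLocal_le_thetaLocal (hmono : Cor312Vol.LogvolMono P) (i : Fin T.lstar) (vQ : T.VQ)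
    (hP : P.SlotHullDefined (labelSucc i) vQ) :
    P.thetaSlotLocal (labelSucc i) vQ ≤ P.thetaLocal (labelSucc i) vQ := by
  by_cases hU : P.HullDefined (labelSucc i) vQ
  · have h := P.thetaSlotLocal_untopD_le_thetaLocal_untopD hmono i vQ hU hP
    have hUeq : (P.thetaLocal (labelSucc i) vQ).untopD 0 = (S.D P.n).logvol _ vQ (P.thetaHull (labelSucc i) vQ) := by
      unfold thetaLocal; rw [if_pos hU, WithTop.untopD_coe]
    rw [P.thetaSlotLocal_untopD_eq hP, hUeq] at h
    rw [P.thetaSlotLocal_eq_coe hP]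
    unfold thetaLocal
    rw [if_pos hU]
    exact WithTop.coe_le_coe.mpr h
  · unfold thetaLocal
    rw [if_neg hU]
    exact le_top

/-! ## §2. The numbers: `−|log(Θ)|_(P) ≤ −|log(Θ)|_(U)` and `SlotStatement ⟹ Statement` -/

/-- `ThetaSlotFinite` from finiteness of `−|log(Θ)|_(P)` (the number is `+∞` otherwise, by definition). [folklore] -/
theorem thetaSlotFinite_of_negLogThetaSlot_ne_top (h : P.negLogThetaSlot ≠ ⊤) : P.ThetaSlotFinite := by
  by_contra hn
  apply h
  unfold negLogThetaSlot
  rw [if_neg hn]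

/-- `ThetaFinite` from finiteness of `−|log(Θ)|_(U)`. [folklore] -/
theorem thetaFinite_of_negLogTheta_ne_top (h : P.negLogTheta ≠ ⊤) : P.ThetaFinite := by
  by_contra hn
  apply h
  unfold negLogTheta
  rw [if_neg hn]

/-- **`−|log(Θ)|_(P) ≤ −|log(Θ)|_(U)`** over any typed setting with monotone log-volume: the procession-normalised sum of the SLOT-hull
log-volumes (reading (P), Dupuy–Hilado / [IUTchIII] Step (x)) is at most that of the hull of the union of all possible images (reading (U),
Cor. 3.12 as printed p. 173–174) — provided `−|log(Θ)|_(P)` is finite (`ThetaSlotFinite`); when `−|log(Θ)|_(U) = +∞` there is nothing to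
prove. [cite: Mochizuki2012, IUTchIII Cor. 3.12 p. 173–174, proof Step (x) p. 181; Prop. 3.9 (ii) p. 116] [cite: DupuyHilado2025, §4.12]
[claim: Mochizuki2012, status: disputed] -/
theorem negLogThetaSlot_le_negLogTheta (hmono : Cor312Vol.LogvolMono P) (hfinP : P.ThetaSlotFinite) :
    P.negLogThetaSlot ≤ P.negLogTheta := by
  by_cases hfinU : P.ThetaFinite
  · unfold negLogThetaSlot negLogTheta
    rw [if_pos hfinP, if_pos hfinU, WithTop.coe_le_coe]
    unfold processionNormalized
    refine div_le_div_of_nonneg_right (Finset.sum_le_sum fun i _ => ?_) (Nat.cast_nonneg _)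
    have hU : ∀ vQ : T.VQ, P.HullDefined (labelSucc i) vQ := fun vQ => by
      by_contra hb
      exact hfinU.1 i vQ (by unfold thetaLocal; rw [if_neg hb])
    exact finsum_le_finsum' (hfinP.2 i) (hfinU.2 i) fun vQ =>
      P.thetaSlotLocal_untopD_le_thetaLocal_untopD hmono i vQ (hU vQ) (P.slotHullDefined_of_finite hfinP i vQ)
  · unfold negLogTheta
    rw [if_neg hfinU]
    exact le_top

/-- **`SlotStatement ⟹ Statement`** ((P) ⟹ (U) at the level of [IUTchIII] Cor. 3.12's CONCLUSION; the number-level twin of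
abc-iut-C-cert-2's region-level `licence_of_slotLicence`): if `−|log(Θ)|_(U)` is finite (`ThetaFinite`, «the quantity −|log(Θ)| is finite»,
p. 175 l. 2–4) and the log-volume is monotone, then `−|log(q)| ≤ −|log(Θ)|_(P)` gives `−|log(q)| ≤ −|log(Θ)|_(U)`. Consequently the γ
certificate's reading-(P) statement binder implies the (U) statement binder at every such datum. Nothing asserted about either statement.
[cite: Mochizuki2012, IUTchIII Cor. 3.12 p. 174 l. 16–18, p. 175 l. 2–4; Prop. 3.9 (ii) p. 116] [claim: Mochizuki2012, status: disputed] -/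
theorem statement_of_slotStatement (hmono : Cor312Vol.LogvolMono P) (hfinU : P.ThetaFinite) (h : P.SlotStatement) :
    P.Statement := by
  have hne : P.negLogTheta ≠ ⊤ := by
    unfold negLogTheta
    rw [if_pos hfinU]
    exact WithTop.coe_ne_top
  exact ⟨hne, h.2.trans (P.negLogThetaSlot_le_negLogTheta hmono (P.thetaSlotFinite_of_negLogThetaSlot_ne_top h.1))⟩

/-- Real form under both finiteness hypotheses: `(−|log(Θ)|_(P)).untopD 0 ≤ (−|log(Θ)|_(U)).untopD 0`. [folklore] -/
theorem negLogThetaSlot_untopD_le (hmono : Cor312Vol.LogvolMono P) (hfinP : P.ThetaSlotFinite) (hfinU : P.ThetaFinite) :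
    P.negLogThetaSlot.untopD 0 ≤ P.negLogTheta.untopD 0 := by
  have h := P.negLogThetaSlot_le_negLogTheta hmono hfinP
  unfold negLogThetaSlot negLogTheta at h ⊢
  rw [if_pos hfinP, if_pos hfinU] at h ⊢
  rw [WithTop.untopD_coe, WithTop.untopD_coe]
  exact WithTop.coe_le_coe.mp h

/-! ## §3. Coincidence from local equalities (the slot-constant / region-hull situations) -/

/-- If the two local terms agree at every `(j, v_ℚ)`, `j ∈ 𝔽_l^⋇`, the two finiteness conditions are equivalent. [folklore] -/
theorem thetaSlotFinite_iff_thetaFinite_of_forall_eq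
    (h : ∀ (i : Fin T.lstar) (vQ : T.VQ), P.thetaSlotLocal (labelSucc i) vQ = P.thetaLocal (labelSucc i) vQ) :
    P.ThetaSlotFinite ↔ P.ThetaFinite := by
  unfold ThetaSlotFinite ThetaFinite
  simp only [h]

/-- **`−|log(Θ)|_(P) = −|log(Θ)|_(U)` from local equalities**: if at every `(j, v_ℚ)`, `j ∈ 𝔽_l^⋇`, the slot-hull local term equals the
full-hull local term (e.g. the full hull is already the (Ind3)-region there, abc-iut-s2-p7 `thetaSlotLocal_eq_thetaLocal_of_thetaHull_subset`;
or the datum is slot-constant, part (ii)), then the two numbers coincide — READING (P) COSTS NOTHING MORE THAN READING (U) there.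
[cite: Mochizuki2012, IUTchIII Cor. 3.12 p. 173–174, proof Step (x) p. 181] [cite: DupuyHilado2025, §4.12] [claim: Mochizuki2012, status: disputed] -/
theorem negLogThetaSlot_eq_negLogTheta_of_forall_eq
    (h : ∀ (i : Fin T.lstar) (vQ : T.VQ), P.thetaSlotLocal (labelSucc i) vQ = P.thetaLocal (labelSucc i) vQ) :
    P.negLogThetaSlot = P.negLogTheta := by
  unfold negLogThetaSlot negLogTheta
  by_cases hfin : P.ThetaSlotFinite
  · rw [if_pos hfin, if_pos ((P.thetaSlotFinite_iff_thetaFinite_of_forall_eq h).mp hfin)]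
    simp only [h]
  · rw [if_neg hfin, if_neg (fun hU => hfin ((P.thetaSlotFinite_iff_thetaFinite_of_forall_eq h).mpr hU))]

/-- **`SlotStatement ↔ Statement` from equality of the two numbers.** [cite: Mochizuki2012, IUTchIII Cor. 3.12 p. 174 l. 16–18]
[claim: Mochizuki2012, status: disputed] -/
theorem slotStatement_iff_statement_of_negLogThetaSlot_eq (h : P.negLogThetaSlot = P.negLogTheta) :
    P.SlotStatement ↔ P.Statement := by
  unfold SlotStatement Statement
  rw [h]

/-- **`SlotStatement ↔ Statement` from local equalities** (the two readings of [IUTchIII] Cor. 3.12's conclusion COINCIDE wherever the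
slot-hull and full-hull local terms agree at every `(j, v_ℚ)`, `j ∈ 𝔽_l^⋇`). [cite: Mochizuki2012, IUTchIII Cor. 3.12 p. 174 l. 16–18,
proof Step (x) p. 181] [cite: DupuyHilado2025, §4.12] [claim: Mochizuki2012, status: disputed] -/
theorem slotStatement_iff_statement_of_forall_eq
    (h : ∀ (i : Fin T.lstar) (vQ : T.VQ), P.thetaSlotLocal (labelSucc i) vQ = P.thetaLocal (labelSucc i) vQ) :
    P.SlotStatement ↔ P.Statement :=
  P.slotStatement_iff_statement_of_negLogThetaSlot_eq (P.negLogThetaSlot_eq_negLogTheta_of_forall_eq h)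

/-- **Where every full hull is already the (Ind3)-region** (at the labels in `𝔽_l^⋇`), the two readings of the conclusion coincide
(abc-iut-s2-p7 `thetaSlotLocal_eq_thetaLocal_of_thetaHull_subset` packet by packet). [cite: Mochizuki2012, IUTchIII Cor. 3.12 proof Step (x)
p. 181] [claim: Mochizuki2012, status: disputed] -/
theorem slotStatement_iff_statement_of_thetaHull_subset
    (h : ∀ (i : Fin T.lstar) (vQ : T.VQ), P.thetaHull (labelSucc i) vQ ⊆ P.thetaRegion3 (labelSucc i) vQ) :
    P.SlotStatement ↔ P.Statement :=
  P.slotStatement_iff_statement_of_forall_eq fun i vQ => P.thetaSlotLocal_eq_thetaLocal_of_thetaHull_subset (h i vQ)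

end Summit.ABC.IUTFork.Cor312.Setting

end
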